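import Literature.AlgebraicGeometry.Resolution.AffineBlowupAlgebra
import Mathlib.AlgebraicGeometry.ProjectiveSpectrum.Basic
import HarnessLib

/-!
# Membership of a chart point of `Bl_I(Spec R)` in another chart

Support file for crux stmt-ResolutionOfSingularities-15315
(`FrobeniusLadder.FInjectiveMacaulayfication`, line `Sketch`, seat c5): stub
`stub_awayIotaMemBasicOpenIff` (α7).

For the second step of the characteristic-`3` tower on the non-affine `X₁ = Bl_𝔪 E₈⁰` one must
decide whether a point `awayι_{a}(q)` of the `a`-chart `D₊(at) = Spec (R[It])_{(at)}` of a blowing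
up `Bl_I(Spec R) = Proj R[It]` (`Literature/AlgebraicGeometry/Resolution/AffineBlowup.lean`) lies
in another chart `D₊(bt)`, `b ∈ I`. The criterion proved here: `awayι_{a}(q) ∈ D₊(bt)` iff the
degree-zero fraction `(bt)/(at)` of the chart ring is not in `q`; and that fraction is characterised,
WITHOUT any grading bookkeeping on the user's side, as the unique element `w` of the chart ring
with `reesChart a ha w · a = b` in `R[1/a]` (the chart map `reesChart : (R[It])_{(at)} → R[1/a]`
is injective, `reesChart_injective`, `AffineBlowupAlgebra.lean`).

Proof: Mathlib's `Proj.awayι_preimage_basicOpen` computes the preimage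
`awayι_{a} ⁻¹ D₊(bt) = D(t_{ab})` with `t_{ab} = Away.isLocalizationElem = (bt)^1/(at)^1`
(Stacks 0804: `D₊(a^{(1)}) ∩ D₊(b^{(1)})` is the principal open of `Spec R[I/a]` defined by
`b/a`); `reesChart` sends `t_{ab}` to `b/a` (`reesChart_mk`), so `t_{ab} = w` by injectivity of
`reesChart` and invertibility of `a` in `R[1/a]`.

* `reesChart_isLocalizationElem` — `reesChart ((bt)/(at)) = b · a⁻¹`;
* `eq_isLocalizationElem_of_reesChart_mul` — `reesChart w · a = b → w = (bt)/(at)`;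
* `stub_awayIotaMemBasicOpenIff` — the membership criterion.

References: The Stacks Project, Tag 0804 (blowing up is `Proj` of the Rees algebra; the charts
`D₊(a^{(1)}) = Spec R[I/a]` and their intersections). [StacksProject]
-/

-- single-problem summit: the doubled namespace component is forced
set_option linter.dupNamespace false

noncomputable section

namespace Summit.ResolutionOfSingularities.ResolutionOfSingularities.Theorems.FInjectiveMacaulayfication.AwayIotaMemBasicOpen

open AlgebraicGeometry Literature.AlgebraicGeometry.Resolution
open Polynomial

universe u

/-- **The chart map on the transition element**: `reesChart` sends the degree-zero fraction
`(bt)^1/(at)^1 = Away.isLocalizationElem` of the chart ring `(R[It])_{(at)}` to `b · a⁻¹ ∈ R[1/a]`.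
[cite: StacksProject, Tag 0804] -/
theorem reesChart_isLocalizationElem {R : Type u} [CommRing R] {I : Ideal R} (a b : R)
    (ha : a ∈ I) (hb : b ∈ I) :
    reesChart a ha (HomogeneousLocalization.Away.isLocalizationElem (reesT_mem a ha) (reesT_mem b hb)) =
      algebraMap R (Localization.Away a) b * IsLocalization.Away.invSelf a := by
  have hr : (((reesT b hb) ^ 1 : reesAlgebra I) : R[X]) = monomial 1 b := by
    rw [pow_one, coe_reesT]
  rw [← pow_one (IsLocalization.Away.invSelf a)]
  exact reesChart_mk a ha (n := 1) (x := (reesT b hb) ^ 1) _ hr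

/-- **The transition element is determined by its image in `R[1/a]`**: if `reesChart a ha w · a = b`
in `R[1/a]`, then `w = (bt)/(at)` — since `reesChart` is injective (`R[1/a]` is the localization
of the chart ring at the non-zero-divisor `a`) and `a` is a unit of `R[1/a]`.
[cite: StacksProject, Tag 0804] -/
theorem eq_isLocalizationElem_of_reesChart_mul {R : Type u} [CommRing R] {I : Ideal R} (a b : R)
    (ha : a ∈ I) (hb : b ∈ I) (w : HomogeneousLocalization.Away (reesGrading I) (reesT a ha))
    (hw : reesChart a ha w * algebraMap R (Localization.Away a) a =
      algebraMap R (Localization.Away a) b) :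
    w = HomogeneousLocalization.Away.isLocalizationElem (reesT_mem a ha) (reesT_mem b hb) := by
  apply reesChart_injective a ha
  rw [reesChart_isLocalizationElem]
  refine (IsUnit.mul_left_inj
    (IsLocalization.Away.algebraMap_isUnit (S := Localization.Away a) a)).mp ?_
  rw [hw, div_mul_algebraMap]

/-- **α7: membership of a chart point of `Bl_I(Spec R)` in another chart.** For `a, b ∈ I`, a
point `q` of the chart `D₊(at) = Spec (R[It])_{(at)}` of the blowing up `Proj R[It]`, and the
element `w` of the chart ring with `reesChart a ha w · a = b` in `R[1/a]` (i.e. `w = "b/a"`), the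
image `awayι_{at}(q) ∈ Proj R[It]` lies in the chart `D₊(bt)` iff `w ∉ q` (Stacks 0804: on
`D₊(a^{(1)}) = Spec R[I/a]` the open `D₊(a^{(1)}) ∩ D₊(b^{(1)})` is `D(b/a)`; Mathlib:
`Proj.awayι_preimage_basicOpen`). [cite: StacksProject, Tag 0804] -/
theorem stub_awayIotaMemBasicOpenIff : ∀ (R : Type) [CommRing R] (I : Ideal R) (a b : R) (ha : a ∈ I) (hb : b ∈ I)
    (q : PrimeSpectrum (HomogeneousLocalization.Away (reesGrading I) (reesT a ha)))
    (w : HomogeneousLocalization.Away (reesGrading I) (reesT a ha)),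
    reesChart a ha w * algebraMap R (Localization.Away a) a = algebraMap R (Localization.Away a) b →
    ((Proj.awayι (reesGrading I) (reesT a ha) (reesT_mem a ha) Nat.one_pos).base q ∈
        Proj.basicOpen (reesGrading I) (reesT b hb) ↔ w ∉ q.asIdeal) := by
  intro R _ I a b ha hb q w hw
  have hw' := eq_isLocalizationElem_of_reesChart_mul a b ha hb w hw
  subst hw'
  change q ∈ Proj.awayι (reesGrading I) (reesT a ha) (reesT_mem a ha) Nat.one_pos ⁻¹ᵁ
      Proj.basicOpen (reesGrading I) (reesT b hb) ↔ _
  rw [Proj.awayι_preimage_basicOpen (reesGrading I) (reesT_mem a ha) Nat.one_pos (reesT_mem b hb)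
    Nat.one_pos]
  exact PrimeSpectrum.mem_basicOpen _ q

end Summit.ResolutionOfSingularities.ResolutionOfSingularities.Theorems.FInjectiveMacaulayfication.AwayIotaMemBasicOpen

end
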